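import Literature.Analysis.ODE.RegularLevelCurvesFlowBox
import Literature.Analysis.Calculus.RollePerturbation
import Mathlib.Analysis.Calculus.Deriv.Pow
import Mathlib.Data.Set.Card
import Mathlib.Data.Set.Card.Arithmetic
import Mathlib.Algebra.Ring.Periodic
import HarnessLib

/-!
# Regular level curves III: the Rolle–Khovanskii count

Topic `Literature/Analysis/ODE`, sequel to `RegularLevelCurves.lean` and
`RegularLevelCurvesFlowBox.lean`. The counting theorem at the heart of Khovanskii's method
(A. G. Khovanskii, *Fewnomials*, Transl. Math. Monogr. 88 (1991), Ch. III, "Analogues of the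
theorems of Rolle and Bezout for separating solutions of Pfaff equations"; used by A. J. Wilkie,
*On the theory of the real exponential field*, Illinois J. Math. 33 (1989), §5, through
Khovanskii's finiteness theorem): for a regular level curve `Γ = H⁻¹(0) ⊆ ℝ^{d+1}` with tangent
field `v`, `C¹` functions `g, P` with `dg(v) = κ P` on `Γ` (`κ > 0`), and a finite set `Z` of zeros
of `g` on `Γ` with `P ≠ 0` (the non-degenerate zeros of the square system `(H, g)`),

`2 · #Z ≤ 2 · #{z ∈ Γ : P = δ, dP(v) ≠ 0} + #{z ∈ Γ : Σ zⱼ² = R, Σ zⱼ vⱼ ≠ 0}`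

for suitable `δ` arbitrarily small and `R` arbitrarily large (`LevelCurveData.two_mul_card_le_of_zeros`).
Both sets on the right are sets of non-degenerate zeros of square systems — `(H, P - δ)` and
`(H, Σ zⱼ² - R)` — which is what makes the estimate iterable. Everything is **proved**:

* `LevelCurveData.hasDerivAt_comp_traj`, `hasDerivAt_sum_sq_traj` — chain rule along trajectories;
* `LevelCurveData.card_le_encard_levelSet_traj` — on one trajectory: `#Z ≤ #{P = δ} + 1`, and
  `#Z ≤ #{P = δ}` on a periodic trajectory (perturbed Rolle lemma of `RollePerturbation.lean`
  along the global parametrisation; `δ` a regular value of `P ∘ γ`, by Sard on the line);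
* `LevelCurveData.two_le_encard_sphere_traj` — an injective trajectory, being proper
  (`RegularLevelCurvesFlowBox.lean`), meets every large generic sphere `Σ zⱼ² = R` at least twice,
  transversally;
* `LevelCurveData.two_mul_card_le_of_zeros` — the count, summing over the finitely many
  (pairwise disjoint) trajectories meeting `Z` and choosing `δ`, `R` outside finitely many null
  sets.

## References

* A. G. Khovanskii, *Fewnomials*, Transl. Math. Monogr. 88, AMS (1991), Ch. III. [Khovanskii1991]
* A. J. Wilkie, *On the theory of the real exponential field*, Illinois J. Math. 33 (1989),
  384–408, §5 (Proposition, p. 402). [Wilkie1989]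
* J.-J. Risler, *Complexité et géométrie réelle (d'après A. Khovansky)*, Sém. Bourbaki 637
  (1984–85), §2.
-/

noncomputable section

open Set Metric Filter Function MeasureTheory
open scoped Topology NNReal

namespace Literature.Analysis.ODE

/-! ### Derivatives along trajectories -/

/-- `‖z‖² ≤ Σⱼ zⱼ²` for the sup norm (the squared Euclidean radius `Σⱼ zⱼ²` is used instead of
the norm because it is a polynomial). [folklore] -/
theorem norm_sq_le_sum_sq {n : ℕ} (z : Fin n → ℝ) : ‖z‖ ^ 2 ≤ ∑ j, z j ^ 2 := by
  have h0 : (0 : ℝ) ≤ ∑ j, z j ^ 2 := Finset.sum_nonneg fun j _ => sq_nonneg (z j)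
  have h1 : ‖z‖ ≤ Real.sqrt (∑ j, z j ^ 2) := by
    refine (pi_norm_le_iff_of_nonneg (Real.sqrt_nonneg _)).2 fun j => ?_
    rw [Real.norm_eq_abs]
    refine Real.abs_le_sqrt ?_
    exact Finset.single_le_sum (fun i _ => sq_nonneg (z i)) (Finset.mem_univ j)
  calc ‖z‖ ^ 2 ≤ Real.sqrt (∑ j, z j ^ 2) ^ 2 := by gcongr
    _ = ∑ j, z j ^ 2 := Real.sq_sqrt h0

namespace LevelCurveData

variable {d : ℕ} (D : LevelCurveData d)

/-- Chain rule along a trajectory: `(f ∘ γ)'(t) = nf(γ t) · df_{γ t}(v(γ t))`. [folklore] -/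
theorem hasDerivAt_comp_traj {f : (Fin (d + 1) → ℝ) → ℝ} (hf : Differentiable ℝ f)
    (z : Fin (d + 1) → ℝ) (t : ℝ) :
    HasDerivAt (fun t => f (D.traj z t))
      (D.nf (D.traj z t) * fderiv ℝ f (D.traj z t) (D.v (D.traj z t))) t := by
  have h := (hf (D.traj z t)).hasFDerivAt.comp_hasDerivAt t (D.hasDerivAt_traj z t)
  rwa [field, map_smul, smul_eq_mul] at h

/-- Derivative of the squared radius along a trajectory:
`(Σ γⱼ²)'(t) = 2 nf(γ t) Σⱼ γⱼ(t) vⱼ(γ t)`. [folklore] -/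
theorem hasDerivAt_sum_sq_traj (z : Fin (d + 1) → ℝ) (t : ℝ) :
    HasDerivAt (fun t => ∑ j, D.traj z t j ^ 2)
      (2 * D.nf (D.traj z t) * ∑ j, D.traj z t j * D.v (D.traj z t) j) t := by
  have h : HasDerivAt (fun t => ∑ j, D.traj z t j ^ 2)
      (∑ j, (2 : ℕ) * D.traj z t j ^ (2 - 1) * D.field (D.traj z t) j) t := by
    refine HasDerivAt.fun_sum fun j _ => ?_
    exact ((hasDerivAt_pi.1 (D.hasDerivAt_traj z t)) j).pow 2
  simp only [Nat.cast_ofNat, Nat.add_one_sub_one, pow_one] at h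
  refine h.congr_deriv ?_
  rw [Finset.mul_sum]
  refine Finset.sum_congr rfl fun j _ => ?_
  rw [field, Pi.smul_apply, smul_eq_mul]
  ring

/-! ### The count on one trajectory -/

section OneTrajectory

variable {g P κ : (Fin (d + 1) → ℝ) → ℝ}

/-- **Perturbed Rolle count on one trajectory.** Let `g' (v) = κ P` on `Γ` with `κ > 0`, and let
`Z` be a finite set of zeros of `g` on the trajectory through `z₀ ∈ Γ` at which `P ≠ 0`. Then for
every sufficiently small level `δ` outside a null set (the critical values of `P` along the
trajectory), the trajectory carries at least `#Z - 1` points — at least `#Z` if the trajectory is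
periodic — where `P = δ` and `dP(v) ≠ 0` (Khovanskii 1991, Ch. III: Rolle's theorem on a line
and on a circle). [cite: Khovanskii1991, Ch. III] -/
theorem card_le_encard_levelSet_traj (hg : Differentiable ℝ g) (hP : ContDiff ℝ 1 P)
    (hκ : ∀ z ∈ D.curve, 0 < κ z) (hgP : ∀ z ∈ D.curve, fderiv ℝ g z (D.v z) = κ z * P z)
    {z₀ : Fin (d + 1) → ℝ} (hz₀ : z₀ ∈ D.curve) (Z : Finset (Fin (d + 1) → ℝ))
    (hZ : ∀ z ∈ Z, z ∈ range (D.traj z₀) ∧ g z = 0 ∧ P z ≠ 0) :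
    ∃ ε > 0, ∃ N : Set ℝ, volume N = 0 ∧ ∀ δ : ℝ, |δ| < ε → δ ∉ N →
      ((Z.card : ℕ∞) ≤
          {z | z ∈ range (D.traj z₀) ∧ P z = δ ∧ fderiv ℝ P z (D.v z) ≠ 0}.encard + 1) ∧
        (¬ Injective (D.traj z₀) → (Z.card : ℕ∞) ≤
          {z | z ∈ range (D.traj z₀) ∧ P z = δ ∧ fderiv ℝ P z (D.v z) ≠ 0}.encard) := by
  classical
  set γ := D.traj z₀ with hγ
  -- the one-variable functions
  set h : ℝ → ℝ := fun t => g (γ t) with hh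
  set p : ℝ → ℝ := fun t => P (γ t) with hp
  set ψ : ℝ → ℝ := fun t => κ (γ t) * D.nf (γ t) with hψ
  have hγΓ : ∀ t, γ t ∈ D.curve := fun t => D.traj_mem_curve hz₀ t
  have hψpos : ∀ t, 0 < ψ t := fun t => mul_pos (hκ _ (hγΓ t)) (D.nf_pos _)
  have hd : ∀ t, HasDerivAt h (ψ t * p t) t := by
    intro t
    have h1 := D.hasDerivAt_comp_traj hg z₀ t
    rw [hgP _ (hγΓ t)] at h1
    convert h1 using 1
    simp only [hψ, hp]; ring
  have hPd : Differentiable ℝ P := hP.differentiable one_ne_zero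
  have hpd : ∀ t, HasDerivAt p (D.nf (γ t) * fderiv ℝ P (γ t) (D.v (γ t))) t := fun t =>
    D.hasDerivAt_comp_traj hPd z₀ t
  have hpdiff : Differentiable ℝ p := fun t => (hpd t).differentiableAt
  have hpc : Continuous p := hpdiff.continuous
  -- the null set of critical values of `p`
  set N : Set ℝ := p '' {c | deriv p c = 0} with hN
  have hNnull : volume N = 0 := Literature.Analysis.Calculus.volume_image_setOf_deriv_eq_zero hpdiff
  -- regular level points are non-degenerate
  have hreg : ∀ δ, δ ∉ N → ∀ c, p c = δ → fderiv ℝ P (γ c) (D.v (γ c)) ≠ 0 := by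
    intro δ hδ c hc hzero
    refine hδ ⟨c, ?_, hc⟩
    show deriv p c = 0
    rw [(hpd c).deriv, hzero, mul_zero]
  -- points of a finite set of times `T` with `p = δ` give level points
  have hsub : ∀ δ, δ ∉ N → ∀ T : Finset ℝ, (∀ c ∈ T, p c = δ) →
      (↑(T.image γ) : Set (Fin (d + 1) → ℝ)) ⊆
        {z | z ∈ range (D.traj z₀) ∧ P z = δ ∧ fderiv ℝ P z (D.v z) ≠ 0} := by
    intro δ hδ T hT z hz
    rw [Finset.coe_image] at hz
    obtain ⟨c, hc, rfl⟩ := hz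
    exact ⟨⟨c, rfl⟩, hT c hc, hreg δ hδ c (hT c hc)⟩
  rcases D.injective_or_periodic hz₀ with hinj | ⟨τ, hτ, hper, hinjτ⟩
  · -- injective trajectory: times are unique
    have htime : ∀ z ∈ Z, ∃ t, γ t = z := fun z hz => (hZ z hz).1
    choose! tOf htOf using htime
    set S : Finset ℝ := Z.image tOf with hS
    have hScard : S.card = Z.card := by
      refine Finset.card_image_of_injOn fun z hz z' hz' he => ?_
      rw [← htOf z hz, ← htOf z' hz']
      exact congrArg γ he
    have hSz : ∀ s ∈ S, h s = 0 ∧ p s ≠ 0 := by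
      intro s hs
      obtain ⟨z, hz, rfl⟩ := Finset.mem_image.1 hs
      simp only [hh, hp, htOf z hz]
      exact ⟨(hZ z hz).2.1, (hZ z hz).2.2⟩
    obtain ⟨ε, hε, hεP⟩ :=
      Literature.Analysis.Calculus.exists_finset_card_le_of_zeros hψpos hd hpc S hSz
    refine ⟨ε, hε, N, hNnull, fun δ hδ hδN => ⟨?_, fun h => (h hinj).elim⟩⟩
    obtain ⟨T, hT, hTP⟩ := hεP δ hδ
    have h1 : ((T.image γ).card : ℕ∞) ≤
        {z | z ∈ range (D.traj z₀) ∧ P z = δ ∧ fderiv ℝ P z (D.v z) ≠ 0}.encard := by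
      rw [← Set.encard_coe_eq_coe_finsetCard]
      exact Set.encard_le_encard (hsub δ hδN T fun c hc => (hTP c hc).1)
    rw [Finset.card_image_of_injective _ hinj] at h1
    calc (Z.card : ℕ∞) = S.card := by rw [hScard]
      _ ≤ (T.card : ℕ∞) + 1 := by exact_mod_cast hT
      _ ≤ _ := by gcongr
  · -- periodic trajectory with least period `τ`: times in `[0, τ)`
    have hperiodic : Function.Periodic γ τ := hper
    have htime : ∀ z ∈ Z, ∃ t ∈ Ico (0 : ℝ) τ, γ t = z := by
      intro z hz
      obtain ⟨t, rfl⟩ := (hZ z hz).1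
      obtain ⟨y, hy, he⟩ := hperiodic.exists_mem_Ico₀ hτ t
      exact ⟨y, hy, he.symm⟩
    choose! tOf htOfmem htOf using htime
    set S : Finset ℝ := Z.image tOf with hS
    have hScard : S.card = Z.card := by
      refine Finset.card_image_of_injOn fun z hz z' hz' he => ?_
      rw [← htOf z hz, ← htOf z' hz']
      exact congrArg γ he
    rcases Z.eq_empty_or_nonempty with rfl | hZne
    · exact ⟨1, one_pos, N, hNnull, fun δ _ _ => ⟨by simp, fun _ => by simp⟩⟩
    have hSne : S.Nonempty := hZne.image _
    set s₀ := S.min' hSne with hs₀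
    have hs₀S : s₀ ∈ S := S.min'_mem hSne
    have hSIco : ∀ s ∈ S, s ∈ Ico (0 : ℝ) τ := by
      intro s hs
      obtain ⟨z, hz, rfl⟩ := Finset.mem_image.1 hs
      exact htOfmem z hz
    have hSz : ∀ s ∈ S, h s = 0 ∧ p s ≠ 0 := by
      intro s hs
      obtain ⟨z, hz, rfl⟩ := Finset.mem_image.1 hs
      simp only [hh, hp, htOf z hz]
      exact ⟨(hZ z hz).2.1, (hZ z hz).2.2⟩
    have hnot : s₀ + τ ∉ S := by
      intro hmem
      have h1 := (hSIco _ hmem).2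
      have h2 := (hSIco _ hs₀S).1
      linarith
    set S' := insert (s₀ + τ) S with hS'
    have hS'z : ∀ s ∈ S', h s = 0 ∧ p s ≠ 0 := by
      intro s hs
      rcases Finset.mem_insert.1 hs with rfl | hs
      · simp only [hh, hp]
        rw [hperiodic s₀]
        exact hSz s₀ hs₀S
      · exact hSz s hs
    obtain ⟨ε, hε, hεP⟩ :=
      Literature.Analysis.Calculus.exists_finset_card_le_of_zeros hψpos hd hpc S' hS'z
    refine ⟨ε, hε, N, hNnull, fun δ hδ hδN => ?_⟩
    suffices hmain : (Z.card : ℕ∞) ≤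
        {z | z ∈ range (D.traj z₀) ∧ P z = δ ∧ fderiv ℝ P z (D.v z) ≠ 0}.encard from
      ⟨hmain.trans le_self_add, fun _ => hmain⟩
    obtain ⟨T, hT, hTP⟩ := hεP δ hδ
    -- `T ⊆ (s₀, s₀ + τ)`, where `γ` is injective
    have hTI : ∀ c ∈ T, c ∈ Ico s₀ (s₀ + τ) := by
      intro c hc
      obtain ⟨-, ⟨s, hs, hsc⟩, s', hs', hcs'⟩ := hTP c hc
      constructor
      · rcases Finset.mem_insert.1 hs with rfl | hs
        · linarith
        · exact (S.min'_le s hs).trans hsc.le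
      · rcases Finset.mem_insert.1 hs' with rfl | hs'
        · exact hcs'
        · have := (hSIco s' hs').2
          have h0 := (hSIco s₀ hs₀S).1
          linarith
    have hinjT : Set.InjOn γ ↑T := fun c hc c' hc' he => hinjτ s₀ (hTI c hc) (hTI c' hc') he
    have h1 : ((T.image γ).card : ℕ∞) ≤
        {z | z ∈ range (D.traj z₀) ∧ P z = δ ∧ fderiv ℝ P z (D.v z) ≠ 0}.encard := by
      rw [← Set.encard_coe_eq_coe_finsetCard]
      exact Set.encard_le_encard (hsub δ hδN T fun c hc => (hTP c hc).1)
    rw [Finset.card_image_of_injOn hinjT] at h1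
    have hcard' : S'.card = S.card + 1 := Finset.card_insert_of_notMem hnot
    calc (Z.card : ℕ∞) = S.card := by rw [hScard]
      _ ≤ (T.card : ℕ∞) := by
          have : S'.card ≤ T.card + 1 := hT
          exact_mod_cast (by omega : S.card ≤ T.card)
      _ ≤ _ := by simpa using h1

/-- **Two sphere points on every injective trajectory.** On an injective trajectory through
`z₀ ∈ Γ` (which is proper in both time directions), for every level `R > Σ (z₀)ⱼ²` outside a null
set (the critical values of the squared radius along the trajectory) there are at least two
points with `Σ zⱼ² = R` and `Σ zⱼ vⱼ(z) ≠ 0` (Khovanskii 1991, Ch. III: a non-compact phase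
curve meets a large generic sphere at least twice). [cite: Khovanskii1991, Ch. III] -/
theorem two_le_encard_sphere_traj {z₀ : Fin (d + 1) → ℝ} (hz₀ : z₀ ∈ D.curve)
    (hinj : Injective (D.traj z₀)) :
    ∃ M : Set ℝ, volume M = 0 ∧ ∀ R : ℝ, (∑ j, z₀ j ^ 2) < R → R ∉ M →
      2 ≤ {z | z ∈ range (D.traj z₀) ∧ (∑ j, z j ^ 2) = R ∧ ∑ j, z j * D.v z j ≠ 0}.encard := by
  set γ := D.traj z₀ with hγ
  set q : ℝ → ℝ := fun t => (∑ j, (γ t) j ^ 2) with hq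
  have hqd : ∀ t, HasDerivAt q (2 * D.nf (γ t) * ∑ j, γ t j * D.v (γ t) j) t :=
    fun t => D.hasDerivAt_sum_sq_traj z₀ t
  have hqdiff : Differentiable ℝ q := fun t => (hqd t).differentiableAt
  have hqc : Continuous q := hqdiff.continuous
  set M : Set ℝ := q '' {c | deriv q c = 0} with hM
  refine ⟨M, Literature.Analysis.Calculus.volume_image_setOf_deriv_eq_zero hqdiff,
    fun R hR hRM => ?_⟩
  have hreg : ∀ t, q t = R → ∑ j, γ t j * D.v (γ t) j ≠ 0 := by
    intro t ht hzero
    refine hRM ⟨t, ?_, ht⟩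
    show deriv q t = 0
    rw [(hqd t).deriv, hzero, mul_zero]
  -- `q → ∞` in both time directions
  have hq_top : Tendsto q atTop atTop := by
    have h1 : Tendsto (fun t => ‖γ t‖ ^ 2) atTop atTop :=
      (tendsto_pow_atTop two_ne_zero).comp (D.tendsto_norm_traj_atTop hz₀ hinj)
    exact tendsto_atTop_mono (fun t => norm_sq_le_sum_sq (γ t)) h1
  have hq_bot : Tendsto q atBot atTop := by
    have h1 : Tendsto (fun t => ‖γ t‖ ^ 2) atBot atTop :=
      (tendsto_pow_atTop two_ne_zero).comp (D.tendsto_norm_traj_atBot hz₀ hinj)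
    exact tendsto_atTop_mono (fun t => norm_sq_le_sum_sq (γ t)) h1
  have hq0 : q 0 = (∑ j, z₀ j ^ 2) := by simp [hq, hγ]
  -- a time `tp > 0` and a time `tm < 0` with `q = R`
  obtain ⟨Tp, hTppos, hTp⟩ : ∃ T, 0 < T ∧ R ≤ q T := by
    obtain ⟨T, hT⟩ := (hq_top.eventually (eventually_ge_atTop R)).and (eventually_gt_atTop 0)
      |>.exists
    exact ⟨T, hT.2, hT.1⟩
  obtain ⟨Tm, hTmneg, hTm⟩ : ∃ T, T < 0 ∧ R ≤ q T := by
    obtain ⟨T, hT⟩ := (hq_bot.eventually (eventually_ge_atTop R)).and (eventually_lt_atBot 0)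
      |>.exists
    exact ⟨T, hT.2, hT.1⟩
  obtain ⟨tp, htp, hqtp⟩ : ∃ t ∈ Icc 0 Tp, q t = R :=
    intermediate_value_Icc hTppos.le hqc.continuousOn ⟨by rw [hq0]; exact hR.le, hTp⟩
  obtain ⟨tm, htm, hqtm⟩ : ∃ t ∈ Icc Tm 0, q t = R :=
    intermediate_value_Icc' hTmneg.le hqc.continuousOn ⟨by rw [hq0]; exact hR.le, hTm⟩
  have htp0 : tp ≠ 0 := by rintro rfl; rw [hq0] at hqtp; linarith
  have htm0 : tm ≠ 0 := by rintro rfl; rw [hq0] at hqtm; linarith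
  have hne : γ tm ≠ γ tp := by
    intro he
    have := hinj he
    have h1 : tm < tp := (lt_of_le_of_ne htm.2 htm0).trans (lt_of_le_of_ne htp.1 (Ne.symm htp0))
    exact h1.ne this
  have hsub : ({γ tm, γ tp} : Set (Fin (d + 1) → ℝ)) ⊆
      {z | z ∈ range (D.traj z₀) ∧ (∑ j, z j ^ 2) = R ∧ ∑ j, z j * D.v z j ≠ 0} := by
    intro z hz
    rcases hz with rfl | rfl
    · exact ⟨⟨tm, rfl⟩, hqtm, hreg tm hqtm⟩
    · exact ⟨⟨tp, rfl⟩, hqtp, hreg tp hqtp⟩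
  calc (2 : ℕ∞) = ({γ tm, γ tp} : Set (Fin (d + 1) → ℝ)).encard := (Set.encard_pair hne).symm
    _ ≤ _ := Set.encard_le_encard hsub

end OneTrajectory

/-! ### Assembly over the trajectories meeting a finite set of zeros -/

/-- Distinct trajectories (as point sets) are disjoint. [folklore] -/
theorem disjoint_range_traj {z z' : Fin (d + 1) → ℝ}
    (h : range (D.traj z) ≠ range (D.traj z')) : Disjoint (range (D.traj z)) (range (D.traj z')) := by
  rw [Set.disjoint_iff]
  rintro x ⟨hx, hx'⟩
  exact h ((D.range_traj_eq_of_mem hx).symm.trans (D.range_traj_eq_of_mem hx'))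

/-- **The Rolle–Khovanskii count** (Khovanskii 1991, Ch. III; used by Wilkie, Illinois J. Math.
33 (1989), §5, through Khovanskii's finiteness theorem). Let `Γ = H⁻¹(0) ⊆ ℝ^{d+1}` be a regular
level curve with tangent field `v`, let `g, P` be `C¹` functions and `κ > 0` on `Γ` with
`dg(v) = κ · P` on `Γ`, and let `Z` be a finite set of zeros of `g` on `Γ` at which `P ≠ 0`
(non-degenerate zeros of `(H, g)`). Then for every `η > 0` and `R₀` there are a level `δ` with
`|δ| < η` and a radius level `R > R₀` such that
`2 · #Z ≤ 2 · #{z ∈ Γ : P(z) = δ, dP(v)(z) ≠ 0} + #{z ∈ Γ : Σ zⱼ² = R, Σ zⱼ vⱼ(z) ≠ 0}`: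
on each trajectory the zeros are separated by points of the level set `P = δ` (one fewer on a
line, as many on a circle), and each line meets the sphere `Σ zⱼ² = R` at least twice; `δ` and `R`
are taken to be regular values along the finitely many trajectories involved, which makes the
counted points non-degenerate zeros of the square systems `(H, P - δ)` and `(H, Σ zⱼ² - R)`.
[cite: Khovanskii1991, Ch. III] [cite: Wilkie1989, §5, Proposition, p. 402] -/
theorem two_mul_card_le_of_zeros {g P κ : (Fin (d + 1) → ℝ) → ℝ} (hg : Differentiable ℝ g)
    (hP : ContDiff ℝ 1 P) (hκ : ∀ z ∈ D.curve, 0 < κ z)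
    (hgP : ∀ z ∈ D.curve, fderiv ℝ g z (D.v z) = κ z * P z) (Z : Finset (Fin (d + 1) → ℝ))
    (hZ : ∀ z ∈ Z, z ∈ D.curve ∧ g z = 0 ∧ P z ≠ 0) {η : ℝ} (hη : 0 < η) (R₀ : ℝ) :
    ∃ δ R : ℝ, |δ| < η ∧ R₀ < R ∧
      2 * (Z.card : ℕ∞) ≤ 2 * {z | z ∈ D.curve ∧ P z = δ ∧ fderiv ℝ P z (D.v z) ≠ 0}.encard
        + {z | z ∈ D.curve ∧ (∑ j, z j ^ 2) = R ∧ ∑ j, z j * D.v z j ≠ 0}.encard := by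
  classical
  -- the trajectories (as point sets) meeting `Z`
  set cls : (Fin (d + 1) → ℝ) → Set (Fin (d + 1) → ℝ) := fun z => range (D.traj z) with hcls
  set K : Finset (Set (Fin (d + 1) → ℝ)) := Z.image cls with hK
  rcases Z.eq_empty_or_nonempty with rfl | hZne
  · exact ⟨0, R₀ + 1, by simpa using hη, by linarith, by simp⟩
  have hKne : K.Nonempty := hZne.image _
  -- a base point of `Z` on each trajectory
  have hbase : ∀ A ∈ K, ∃ b ∈ Z, cls b = A := fun A hA => by
    simpa only [hK, Finset.mem_image] using hA
  choose! b hbZ hbA using hbase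
  have hbΓ : ∀ A ∈ K, b A ∈ D.curve := fun A hA => (hZ _ (hbZ A hA)).1
  have hmem_cls : ∀ z, z ∈ cls z := fun z => ⟨0, D.traj_zero z⟩
  have hA_eq : ∀ A ∈ K, A = range (D.traj (b A)) := fun A hA => (hbA A hA).symm
  -- the zeros on `A`
  set ZA : Set (Fin (d + 1) → ℝ) → Finset (Fin (d + 1) → ℝ) :=
    fun A => Z.filter fun z => cls z = A with hZA
  have hZA : ∀ A ∈ K, ∀ z ∈ ZA A, z ∈ range (D.traj (b A)) ∧ g z = 0 ∧ P z ≠ 0 := by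
    intro A hA z hz
    rw [hZA, Finset.mem_filter] at hz
    refine ⟨?_, (hZ z hz.1).2.1, (hZ z hz.1).2.2⟩
    rw [← hA_eq A hA, ← hz.2]
    exact hmem_cls z
  have hcardZ : Z.card = ∑ A ∈ K, (ZA A).card := Finset.card_eq_sum_card_image cls Z
  -- per-trajectory data
  have hrolle : ∀ A ∈ K, ∃ ε > 0, ∃ N : Set ℝ, volume N = 0 ∧ ∀ δ : ℝ, |δ| < ε → δ ∉ N →
      (((ZA A).card : ℕ∞) ≤
        {z | z ∈ range (D.traj (b A)) ∧ P z = δ ∧ fderiv ℝ P z (D.v z) ≠ 0}.encard + 1) ∧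
      (¬ Injective (D.traj (b A)) → ((ZA A).card : ℕ∞) ≤
        {z | z ∈ range (D.traj (b A)) ∧ P z = δ ∧ fderiv ℝ P z (D.v z) ≠ 0}.encard) :=
    fun A hA => D.card_le_encard_levelSet_traj hg hP hκ hgP (hbΓ A hA) (ZA A) (hZA A hA)
  choose! ε hε N hN hcount using hrolle
  have hsphere : ∀ A ∈ K, ∃ M : Set ℝ, volume M = 0 ∧ (Injective (D.traj (b A)) →
      ∀ R : ℝ, (∑ j, (b A) j ^ 2) < R → R ∉ M →
        2 ≤ {z | z ∈ range (D.traj (b A)) ∧ (∑ j, z j ^ 2) = R ∧ ∑ j, z j * D.v z j ≠ 0}.encard) := by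
    intro A hA
    by_cases hinj : Injective (D.traj (b A))
    · obtain ⟨M, hM, hMP⟩ := D.two_le_encard_sphere_traj (hbΓ A hA) hinj
      exact ⟨M, hM, fun _ => hMP⟩
    · exact ⟨∅, measure_empty, fun h => (hinj h).elim⟩
  choose! M hM hsph using hsphere
  -- choice of `δ`
  set ε₀ := min η (K.inf' hKne ε) with hε₀
  have hε₀pos : 0 < ε₀ := lt_min hη ((Finset.lt_inf'_iff hKne).2 fun A hA => hε A hA)
  have hNnull : volume (⋃ A ∈ K, N A) = 0 :=
    (measure_biUnion_null_iff K.countable_toSet).2 fun A hA => hN A hA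
  obtain ⟨δ, hδ, hδN⟩ :=
    Literature.Analysis.Calculus.exists_abs_lt_notMem_of_volume_eq_zero hNnull hε₀pos
  have hδη : |δ| < η := hδ.trans_le (min_le_left _ _)
  have hδA : ∀ A ∈ K, |δ| < ε A := fun A hA =>
    (hδ.trans_le (min_le_right _ _)).trans_le (Finset.inf'_le ε hA)
  have hδNA : ∀ A ∈ K, δ ∉ N A := fun A hA h => hδN (Set.mem_biUnion hA h)
  -- choice of `R`
  set R₁ := max R₀ (K.sup' hKne fun A => (∑ j, (b A) j ^ 2)) with hR₁
  have hMnull : volume (⋃ A ∈ K, M A) = 0 :=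
    (measure_biUnion_null_iff K.countable_toSet).2 fun A hA => hM A hA
  obtain ⟨R, hR, hRM⟩ :=
    Literature.Analysis.Calculus.exists_mem_Ioo_notMem_of_volume_eq_zero hMnull
      (lt_add_one R₁)
  have hRR₀ : R₀ < R := (le_max_left _ _).trans_lt hR.1
  have hRA : ∀ A ∈ K, (∑ j, (b A) j ^ 2) < R := fun A hA =>
    ((Finset.le_sup' (fun A => (∑ j, (b A) j ^ 2)) hA).trans (le_max_right R₀ _)).trans_lt hR.1
  have hRMA : ∀ A ∈ K, R ∉ M A := fun A hA h => hRM (Set.mem_biUnion hA h)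
  refine ⟨δ, R, hδη, hRR₀, ?_⟩
  -- the level sets, trajectory by trajectory
  set S₁ := {z | z ∈ D.curve ∧ P z = δ ∧ fderiv ℝ P z (D.v z) ≠ 0} with hS₁
  set S₂ := {z | z ∈ D.curve ∧ (∑ j, z j ^ 2) = R ∧ ∑ j, z j * D.v z j ≠ 0} with hS₂
  set T₁ : Set (Fin (d + 1) → ℝ) → Set (Fin (d + 1) → ℝ) :=
    fun A => {z | z ∈ range (D.traj (b A)) ∧ P z = δ ∧ fderiv ℝ P z (D.v z) ≠ 0} with hT₁
  set T₂ : Set (Fin (d + 1) → ℝ) → Set (Fin (d + 1) → ℝ) :=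
    fun A => {z | z ∈ range (D.traj (b A)) ∧ (∑ j, z j ^ 2) = R ∧ ∑ j, z j * D.v z j ≠ 0} with hT₂
  have hT₁A : ∀ A ∈ K, T₁ A ⊆ A := fun A hA z hz => by rw [hA_eq A hA]; exact hz.1
  have hT₂A : ∀ A ∈ K, T₂ A ⊆ A := fun A hA z hz => by rw [hA_eq A hA]; exact hz.1
  have hT₁S : ∀ A ∈ K, T₁ A ⊆ S₁ := fun A hA z hz => by
    obtain ⟨⟨t, rfl⟩, h2, h3⟩ := hz
    exact ⟨D.traj_mem_curve (hbΓ A hA) t, h2, h3⟩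
  have hT₂S : ∀ A ∈ K, T₂ A ⊆ S₂ := fun A hA z hz => by
    obtain ⟨⟨t, rfl⟩, h2, h3⟩ := hz
    exact ⟨D.traj_mem_curve (hbΓ A hA) t, h2, h3⟩
  have hdisjK : ∀ A ∈ K, ∀ A' ∈ K, A ≠ A' → Disjoint A A' := by
    intro A hA A' hA' hne
    rw [hA_eq A hA, hA_eq A' hA'] at hne ⊢
    exact D.disjoint_range_traj hne
  have hsum₁ : ∑ A ∈ K, (T₁ A).encard ≤ S₁.encard := by
    have hd : (K : Set (Set (Fin (d + 1) → ℝ))).PairwiseDisjoint T₁ := fun A hA A' hA' hne =>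
      (hdisjK A hA A' hA' hne).mono (hT₁A A hA) (hT₁A A' hA')
    rw [← finsum_mem_coe_finset, ← K.finite_toSet.encard_biUnion hd]
    exact Set.encard_le_encard (Set.iUnion₂_subset fun A hA => hT₁S A hA)
  have hsum₂ : ∑ A ∈ K, (T₂ A).encard ≤ S₂.encard := by
    have hd : (K : Set (Set (Fin (d + 1) → ℝ))).PairwiseDisjoint T₂ := fun A hA A' hA' hne =>
      (hdisjK A hA A' hA' hne).mono (hT₂A A hA) (hT₂A A' hA')
    rw [← finsum_mem_coe_finset, ← K.finite_toSet.encard_biUnion hd]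
    exact Set.encard_le_encard (Set.iUnion₂_subset fun A hA => hT₂S A hA)
  -- per-trajectory inequality `2 #Z_A ≤ 2 #T₁ A + #T₂ A`
  have hper : ∀ A ∈ K, 2 * ((ZA A).card : ℕ∞) ≤ 2 * (T₁ A).encard + (T₂ A).encard := by
    intro A hA
    have h1 := hcount A hA δ (hδA A hA) (hδNA A hA)
    by_cases hinj : Injective (D.traj (b A))
    · have h2 := hsph A hA hinj R (hRA A hA) (hRMA A hA)
      calc 2 * ((ZA A).card : ℕ∞) ≤ 2 * ((T₁ A).encard + 1) := by gcongr; exact h1.1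
        _ = 2 * (T₁ A).encard + 2 := by ring
        _ ≤ 2 * (T₁ A).encard + (T₂ A).encard := by gcongr
    · calc 2 * ((ZA A).card : ℕ∞) ≤ 2 * (T₁ A).encard := by gcongr; exact h1.2 hinj
        _ ≤ 2 * (T₁ A).encard + (T₂ A).encard := le_self_add
  calc 2 * (Z.card : ℕ∞) = ∑ A ∈ K, 2 * ((ZA A).card : ℕ∞) := by
        rw [hcardZ, Nat.cast_sum, Finset.mul_sum]
    _ ≤ ∑ A ∈ K, (2 * (T₁ A).encard + (T₂ A).encard) := Finset.sum_le_sum hper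
    _ = 2 * ∑ A ∈ K, (T₁ A).encard + ∑ A ∈ K, (T₂ A).encard := by
        rw [Finset.sum_add_distrib, Finset.mul_sum]
    _ ≤ 2 * S₁.encard + S₂.encard := by gcongr

end LevelCurveData

end Literature.Analysis.ODE
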